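import Mathlib.Analysis.SpecialFunctions.Pow.Real
import Mathlib.GroupTheory.Perm.Cycle.Type
import Summits.MatrixMultiplication.MatrixMultiplication.Statement
import Literature.Computability.AlgebraicComplexity.CohnUmansAlphaGammaBound
import Literature.Computability.AlgebraicComplexity.PseudoExponentBounds
import Literature.Computability.AlgebraicComplexity.FlatteningBound
import Literature.Computability.AlgebraicComplexity.GroupAlgebraRankBounds
import Literature.RepresentationTheory.FiniteGroups.WedderburnBlocks
import Literature.RepresentationTheory.FiniteGroups.VershikKerovMaxDegreeProofs
import Literature.RepresentationTheory.FiniteGroups.VershikKerovLimitShape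
import Literature.Combinatorics.Enumerative.PartitionNumberUpperBound
import Literature.Barriers.MatrixMultiplication.QuasirandomBarrierLieTypeProofs
import HarnessLib

/-!
# The symmetric-group window for the Cohn–Umans door

Door D2 (`SoloInformedGroupDoor.lean`: `matrixMultiplication_of_tppFamily` = Cohn–Umans 2003, Cor. 4.3)
wants finite groups with TPP triples of size `|G|^{3/2-o(1)}` and small character degrees.  For
`S_k = Equiv.Perm (Fin k)` the degrees are controlled in the tree by the DISCHARGED Vershik–Kerov
theorem `√(k!)e^{-(c₁+ε)√k} ≤ D(k) ≤ √(k!)e^{-(c₂-ε)√k}` (`VershikKerov1985_maxCharDegree_holds`;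
lower half with `ε = 0`: `VershikKerov1985_maxCharDegree_lower`), `D(k) = maxCharDegree S_k = max_λ f^λ`,
`c₁ = π/√6`, `c₂ = (π-2)/π²`.  With Cor. 4.2 this makes the door through `S_k` a two-sided WINDOW on the
**packing defect** `f = (3/2)log k! − log(|S||T||U|)` of a TPP triple, against the **degree gap**
`g(k) = (1/2)log k! − log D(k) ∈ [(c₂−o(1))√k, c₁√k]` (`degreeGap_ge`, `degreeGap_le`):

* `omega_le_of_perm_tpp`: Cor. 4.2 in `S_k` is `ω ≤ 6g/(3g − f)` when `D(k)³ < |S||T||U|` (`⇔ f < 3g`);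
  linearised `g·(ω − 2) ≤ f` (`degreeGap_mul_omega_sub_two_le`); for `k ≥ k₀(ε)`,
  `(c₂ − ε)√k·(ω − 2) ≤ f` (`sqrt_mul_omega_sub_two_le`).
* `matrixMultiplication_of_perm_tpp_defect` — **the door through `S_k`, unconditional**: TPP triples in
  `S_{kᵢ}`, `kᵢ → ∞`, with `fᵢ/√kᵢ → 0` give `MatrixMultiplication`.
* `rpow_le_charDegreePowSum_of_le_cube`, `perm_uninformative_of_le` — **the floor**: a triple with
  `|S||T||U| ≤ D³` satisfies `(|S||T||U|)^{w/3} ≤ Σ_χ χ(1)^w` (Thm. 4.1) for EVERY `w ≥ 0`, so certifies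
  nothing; in `S_k` this is every triple of size `≤ (√(k!)e^{−c₁√k})³ = (k!)^{3/2}e^{−3c₁√k}`.
* `mul_packingDefect_lt_of_beats`, `packingDefect_eventually_lt_of_beats` — **necessity**: by the
  power-mean bound `Σ_χ χ(1)^w ≥ (k!)^{w/2}p(k)^{1−w/2}` (`card_rpow_mul_le_charDegreePowSum`, BCGPU 2023,
  proof of Cor. 3.4) and `#Cl(S_k) ≤ p(k) ≤ e^{2c₁√k}` (`natCard_conjClasses_perm_le`,
  `card_partition_le_exp'`), beating the `w`-certificate (`Σ_χ χ(1)^w < (|S||T||U|)^{w/3}`) forces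
  `w·f < 3(w−2)c₁√k`; beating every `w > 2` eventually forces `fᵢ < η√kᵢ` eventually, every `η > 0`.
  With `0 ≤ f` (`packingDefect_nonneg`, Lemma 3.1): the door condition `fᵢ = o(√kᵢ)` is NECESSARY AND
  SUFFICIENT for an `S_k`-family of TPP triples to be an `ω = 2` family in the certificate sense.

So `S_k` (and `A_k`, up to `O(1)` in `f`, `g`) carries a Cohn–Umans `ω = 2` family iff it has TPP
triples of size `(k!)^{3/2}e^{−o(√k)}` — the threshold `|S_k|^{1/2}/e^{o(√k)}` per factor of
Blasiak–Church–Cohn–Grochow–Umans 2017, §4 (tree: `YoungSubgroupBarrier`, whose Thm. 4.2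
`BCCGU2017_thm42_holds` puts every Young-subgroup triple at LINEAR defect, far below the window); this
file adds the explicit constants (`3c₂ ≈ 0.347` informative side, `3c₁ ≈ 3.85` floor side) and the
linear form `g·(ω−2) ≤ f`.  No TPP triple of `S_k` inside the window is known (BCGPU 2023, §5).

References: Cohn–Umans, FOCS 2003, arXiv:math/0307321, Lemma 3.1, Thm. 4.1, Cor. 4.2–4.3
[CohnUmans2003]; Vershik–Kerov, Funct. Anal. Appl. 19 (1985) [VershikKerov1985]; Blasiak–Church–Cohn–
Grochow–Umans, arXiv:1712.02302, §4 [BCCGU2017]; Blasiak–Cohn–Grochow–Pratt–Umans, arXiv:2204.03826,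
Cor. 3.4, §5 [BlasiakCohnGrochowPrattUmans2023]; Apostol, *Introduction to Analytic Number Theory*,
Thm. 14.5 [Apostol1976].
-/

open Filter Topology
open Literature.Computability.AlgebraicComplexity
open Literature.RepresentationTheory.FiniteGroups
open Literature.Combinatorics.Enumerative
open Literature.Barriers.MatrixMultiplication

noncomputable section

namespace Summit.MatrixMultiplication.MatrixMultiplication.Theorems

namespace SnWindow

/-! ## §0 The two numbers -/

/-- The **packing defect** `f = (3/2)·log k! − log N` of a triple of size `N = |S||T||U|` in `S_k`
(`N = (k!)^{3/2}·e^{−f}`; Cohn–Umans 2003, Lemma 3.1 makes it `≥ 0` for TPP triples).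
[cite: CohnUmans2003, Lemma 3.1] -/
def packingDefect (k N : ℕ) : ℝ :=
  3 / 2 * Real.log (k.factorial : ℝ) - Real.log (N : ℝ)

/-- The **degree gap** `g(k) = (1/2)·log k! − log D(k)` of `S_k` (`D(k) = √(k!)·e^{−g(k)}`,
`D(k) = maxCharDegree S_k`; Vershik–Kerov: `g(k) ≍ √k`). [cite: VershikKerov1985, Thm. 1] -/
def degreeGap (k : ℕ) : ℝ :=
  1 / 2 * Real.log (k.factorial : ℝ) - Real.log (maxCharDegree (Equiv.Perm (Fin k)) : ℝ)

/-- `1 ≤ D(k)` (the trivial character). [folklore] -/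
theorem one_le_maxCharDegree_perm (k : ℕ) : 1 ≤ maxCharDegree (Equiv.Perm (Fin k)) :=
  one_le_maxCharDegree' _

/-- `0 < D(k)` in `ℝ`. [folklore] -/
private theorem maxCharDegree_perm_pos (k : ℕ) :
    (0 : ℝ) < (maxCharDegree (Equiv.Perm (Fin k)) : ℝ) := mod_cast one_le_maxCharDegree_perm k

/-- `0 < k!` in `ℝ`. [folklore] -/
private theorem factorial_cast_pos (k : ℕ) : (0 : ℝ) < (k.factorial : ℝ) := mod_cast k.factorial_pos

/-- `0 ≤ g(k)`: `D(k) ≤ √(k!)` (Burnside). [cite: VershikKerov1985, Thm. 1] -/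
theorem degreeGap_nonneg (k : ℕ) : 0 ≤ degreeGap k := by
  have h := Real.log_le_log (maxCharDegree_perm_pos k) (maxCharDegree_perm_le_sqrt_factorial k)
  rw [Real.log_sqrt (factorial_cast_pos k).le] at h
  simp only [degreeGap]
  linarith

/-- `g(k) ≤ c₁√k` for EVERY `k` (the proved lower half of Vershik–Kerov,
`VershikKerov1985_maxCharDegree_lower`). [cite: VershikKerov1985, Thm. 1] -/
theorem degreeGap_le (k : ℕ) : degreeGap k ≤ vkLowerConst * Real.sqrt k := by
  have hpos : 0 < Real.sqrt (k.factorial : ℝ) * Real.exp (-(vkLowerConst * Real.sqrt (k : ℝ))) :=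
    mul_pos (Real.sqrt_pos.mpr (factorial_cast_pos k)) (Real.exp_pos _)
  have h := Real.log_le_log hpos (VershikKerov1985_maxCharDegree_lower k)
  rw [Real.log_mul (Real.sqrt_pos.mpr (factorial_cast_pos k)).ne' (Real.exp_pos _).ne',
    Real.log_exp, Real.log_sqrt (factorial_cast_pos k).le] at h
  simp only [degreeGap]
  linarith

/-- `g(k) ≥ (c₂ − ε)√k` for `k ≥ k₀(ε)` (the upper half of Vershik–Kerov, discharged in the tree:
`VershikKerov1985_maxCharDegree_holds`). [cite: VershikKerov1985, Thm. 1] -/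
theorem degreeGap_ge {ε : ℝ} (hε : 0 < ε) :
    ∃ k₀ : ℕ, ∀ k : ℕ, k₀ ≤ k → (vkUpperConst - ε) * Real.sqrt k ≤ degreeGap k := by
  obtain ⟨k₀, hk₀⟩ := VershikKerov1985_maxCharDegree_holds ε hε
  refine ⟨k₀, fun k hk => ?_⟩
  have h := Real.log_le_log (maxCharDegree_perm_pos k) (hk₀ k hk).2
  rw [Real.log_mul (Real.sqrt_pos.mpr (factorial_cast_pos k)).ne' (Real.exp_pos _).ne',
    Real.log_exp, Real.log_sqrt (factorial_cast_pos k).le] at h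
  simp only [degreeGap]
  linarith

/-- `0 ≤ f` for a TPP triple (Cohn–Umans 2003, Lemma 3.1: `(|S||T||U|)² ≤ |G|³`; with the junk
value `log 0 = 0` the degenerate sizes are covered too). [cite: CohnUmans2003, Lemma 3.1] -/
theorem packingDefect_nonneg {k a b c : ℕ} (h : RealizesTPP (Equiv.Perm (Fin k)) a b c) :
    0 ≤ packingDefect k (a * b * c) := by
  have hL : 0 ≤ Real.log (k.factorial : ℝ) := Real.log_nonneg (by exact_mod_cast k.factorial_pos)
  simp only [packingDefect]
  rcases le_or_gt (a * b * c) 1 with h1 | h1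
  · have : Real.log ((a * b * c : ℕ) : ℝ) = 0 := by
      interval_cases habc : a * b * c <;> simp
    rw [this]
    linarith
  · have h31 := CohnUmans2003_lemma31_log h h1
    rw [Fintype.card_perm, Fintype.card_fin] at h31
    linarith

/-! ## §1 Cor. 4.2 in the window coordinates -/

/-- **Cohn–Umans Cor. 4.2 in `S_k`**: a TPP triple with `D(k)³ < |S||T||U|` gives
`ω ≤ 6g/(3g − f)` (`= 3(log k! − 2 log D)/(log N − 3 log D)`), with `0 < 3g − f`.
[cite: CohnUmans2003, Cor. 4.2] -/
theorem omega_le_of_perm_tpp {k a b c : ℕ} (h : RealizesTPP (Equiv.Perm (Fin k)) a b c)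
    (hlt : maxCharDegree (Equiv.Perm (Fin k)) ^ 3 < a * b * c) :
    0 < 3 * degreeGap k - packingDefect k (a * b * c) ∧
      omega ℂ ≤ 6 * degreeGap k / (3 * degreeGap k - packingDefect k (a * b * c)) := by
  have hmain := CohnUmans2003_cor42 h le_rfl (one_le_maxCharDegree_perm k) hlt
  rw [Nat.card_eq_fintype_card, Fintype.card_perm, Fintype.card_fin] at hmain
  have hden : Real.log ((a * b * c : ℕ) : ℝ) - 3 * Real.log (maxCharDegree (Equiv.Perm (Fin k)) : ℝ)
      = 3 * degreeGap k - packingDefect k (a * b * c) := by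
    simp only [degreeGap, packingDefect]; ring
  have hnum : Real.log (k.factorial : ℝ) - 2 * Real.log (maxCharDegree (Equiv.Perm (Fin k)) : ℝ)
      = 2 * degreeGap k := by
    simp only [degreeGap]; ring
  have hpos : 0 < 3 * degreeGap k - packingDefect k (a * b * c) := by
    have h3 : ((maxCharDegree (Equiv.Perm (Fin k)) : ℝ)) ^ 3 < ((a * b * c : ℕ) : ℝ) := mod_cast hlt
    have := Real.log_lt_log (pow_pos (maxCharDegree_perm_pos k) 3) h3
    rw [Real.log_pow, Nat.cast_ofNat] at this
    rw [← hden]; linarith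
  rw [hnum, hden] at hmain
  refine ⟨hpos, ?_⟩
  calc omega ℂ ≤ 3 * (2 * degreeGap k) / (3 * degreeGap k - packingDefect k (a * b * c)) := hmain
    _ = 6 * degreeGap k / (3 * degreeGap k - packingDefect k (a * b * c)) := by ring

/-- **Linearised: `g(k)·(ω − 2) ≤ f`** for every TPP triple of `S_k` with `D(k)³ < |S||T||U|`
(from `ω(3g − f) ≤ 6g` and `2 ≤ ω ≤ 3`). [cite: CohnUmans2003, Cor. 4.2] -/
theorem degreeGap_mul_omega_sub_two_le {k a b c : ℕ} (h : RealizesTPP (Equiv.Perm (Fin k)) a b c)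
    (hlt : maxCharDegree (Equiv.Perm (Fin k)) ^ 3 < a * b * c) :
    degreeGap k * (omega ℂ - 2) ≤ packingDefect k (a * b * c) := by
  obtain ⟨hpos, hω⟩ := omega_le_of_perm_tpp h hlt
  have hg : 0 ≤ degreeGap k := degreeGap_nonneg k
  have h2 : 2 ≤ omega ℂ := omega_two_le ℂ
  have h3 : omega ℂ ≤ 3 := omega_le_three' ℂ
  have h4 : omega ℂ * (3 * degreeGap k - packingDefect k (a * b * c)) ≤ 6 * degreeGap k :=
    (le_div_iff₀ hpos).mp hω
  rcases le_or_gt 0 (packingDefect k (a * b * c)) with hf | hf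
  · have h5 : 0 ≤ (3 - omega ℂ) * packingDefect k (a * b * c) := mul_nonneg (by linarith) hf
    nlinarith
  · have h5 : 0 ≤ (omega ℂ - 2) * (-packingDefect k (a * b * c)) := mul_nonneg (by linarith) (by linarith)
    have h6 : 0 ≤ degreeGap k * (omega ℂ - 2) := mul_nonneg hg (by linarith)
    nlinarith

/-- **For `k ≥ k₀(ε)`: `(c₂ − ε)√k · (ω − 2) ≤ f`**, i.e. a TPP triple of `S_k` with packing defect
`f ≤ κ√k`, `κ < 3(c₂ − ε)`, proves `ω ≤ 2 + κ/(c₂ − ε)`. [cite: CohnUmans2003, Cor. 4.2] -/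
theorem sqrt_mul_omega_sub_two_le {ε : ℝ} (hε : 0 < ε) :
    ∃ k₀ : ℕ, ∀ k a b c : ℕ, k₀ ≤ k → RealizesTPP (Equiv.Perm (Fin k)) a b c →
      maxCharDegree (Equiv.Perm (Fin k)) ^ 3 < a * b * c →
        (vkUpperConst - ε) * Real.sqrt k * (omega ℂ - 2) ≤ packingDefect k (a * b * c) := by
  obtain ⟨k₀, hk₀⟩ := degreeGap_ge hε
  refine ⟨k₀, fun k a b c hk h hlt => ?_⟩
  have h2 : 0 ≤ omega ℂ - 2 := sub_nonneg.2 (omega_two_le ℂ)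
  exact (mul_le_mul_of_nonneg_right (hk₀ k hk) h2).trans (degreeGap_mul_omega_sub_two_le h hlt)

/-! ## §2 The door through `S_k` (unconditional) -/

/-- `f < 3g` is the hypothesis `D(k)³ < |S||T||U|` of Cor. 4.2. [cite: CohnUmans2003, Cor. 4.2] -/
theorem cube_lt_of_packingDefect_lt {k N : ℕ} (hf : packingDefect k N < 3 * degreeGap k) :
    maxCharDegree (Equiv.Perm (Fin k)) ^ 3 < N := by
  refine lt_of_not_ge fun hle => ?_
  have hD1 : (1 : ℝ) ≤ (maxCharDegree (Equiv.Perm (Fin k)) : ℝ) := by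
    exact_mod_cast one_le_maxCharDegree_perm k
  have hlog : Real.log (N : ℝ) ≤ 3 * Real.log (maxCharDegree (Equiv.Perm (Fin k)) : ℝ) := by
    rcases Nat.eq_zero_or_pos N with h0 | hN
    · rw [h0, Nat.cast_zero, Real.log_zero]
      exact mul_nonneg (by norm_num) (Real.log_nonneg hD1)
    · have h3 : (N : ℝ) ≤ ((maxCharDegree (Equiv.Perm (Fin k)) : ℝ)) ^ 3 := by exact_mod_cast hle
      have := Real.log_le_log (by exact_mod_cast hN) h3
      rwa [Real.log_pow, Nat.cast_ofNat] at this
  have : 3 * degreeGap k ≤ packingDefect k N := by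
    simp only [degreeGap, packingDefect]; linarith
  linarith

/-- **The door through the symmetric groups.**  TPP triples `Sᵢ, Tᵢ, Uᵢ ⊆ S_{kᵢ}` with `kᵢ → ∞`
and packing defect `fᵢ = o(√kᵢ)`, i.e. `|Sᵢ||Tᵢ||Uᵢ| = (kᵢ!)^{3/2}·e^{−o(√kᵢ)}`, give `ω = 2`.
Cohn–Umans Cor. 4.2 + Vershik–Kerov (`g(kᵢ) ≥ (c₂/2)√kᵢ` eventually): `ω − 2 ≤ fᵢ/g(kᵢ) → 0`.
No such triples are known. [cite: CohnUmans2003, Cor. 4.3] -/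
theorem matrixMultiplication_of_perm_tpp_defect (k a b c : ℕ → ℕ) (hk : Tendsto k atTop atTop)
    (h : ∀ i, RealizesTPP (Equiv.Perm (Fin (k i))) (a i) (b i) (c i))
    (hdef : Tendsto (fun i => packingDefect (k i) (a i * b i * c i) / Real.sqrt (k i))
      atTop (𝓝 0)) :
    _root_.MatrixMultiplication := by
  rw [_root_.MatrixMultiplication_iff]
  refine le_antisymm (le_of_forall_pos_le_add fun δ hδ => ?_) (omega_two_le ℂ)
  set δ' := min δ 1
  have hδ'pos : 0 < δ' := lt_min hδ one_pos
  have hδ'le : δ' ≤ δ := min_le_left _ _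
  have hδ'1 : δ' ≤ 1 := min_le_right _ _
  have hc : 0 < vkUpperConst / 2 := half_pos vkUpperConst_pos
  obtain ⟨k₀, hk₀⟩ := degreeGap_ge hc
  have h1 : ∀ᶠ i in atTop, dist (packingDefect (k i) (a i * b i * c i) / Real.sqrt (k i)) 0 <
      δ' * (vkUpperConst / 2) := Metric.tendsto_nhds.mp hdef _ (mul_pos hδ'pos hc)
  have h2 : ∀ᶠ i in atTop, max k₀ 1 ≤ k i := hk.eventually (eventually_ge_atTop _)
  obtain ⟨i, hi1, hi2⟩ := (h1.and h2).exists
  obtain ⟨hkk₀, hk1⟩ := max_le_iff.mp hi2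
  have hsqrt : 0 < Real.sqrt (k i) := Real.sqrt_pos.mpr (by exact_mod_cast hk1)
  have hX : 0 < vkUpperConst / 2 * Real.sqrt (k i) := mul_pos hc hsqrt
  have hg : vkUpperConst / 2 * Real.sqrt (k i) ≤ degreeGap (k i) := by
    have := hk₀ (k i) hkk₀
    convert this using 2
    ring
  have hf : packingDefect (k i) (a i * b i * c i) < δ' * (vkUpperConst / 2 * Real.sqrt (k i)) := by
    rw [Real.dist_eq, sub_zero] at hi1
    have := (div_lt_iff₀ hsqrt).mp (lt_of_abs_lt hi1)
    linarith [this]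
  have hf' : packingDefect (k i) (a i * b i * c i) < 3 * degreeGap (k i) := by
    have : δ' * (vkUpperConst / 2 * Real.sqrt (k i)) ≤ vkUpperConst / 2 * Real.sqrt (k i) :=
      mul_le_of_le_one_left hX.le hδ'1
    linarith [degreeGap_nonneg (k i)]
  have hlt := cube_lt_of_packingDefect_lt hf'
  have hA : vkUpperConst / 2 * Real.sqrt (k i) * (omega ℂ - 2) ≤ packingDefect (k i) (a i * b i * c i) :=
    (mul_le_mul_of_nonneg_right hg (sub_nonneg.2 (omega_two_le ℂ))).trans
      (degreeGap_mul_omega_sub_two_le (h i) hlt)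
  have := lt_of_mul_lt_mul_left ((hA.trans_lt hf).trans_eq (mul_comm _ _)) hX.le
  linarith

/-! ## §3 The floor: triples below `D³` certify nothing -/

/-- **`D_max(G)^w ≤ Σ_χ χ(1)^w`** (one Wedderburn block has size `D_max`). [cite: CohnUmans2003, §1.3] -/
theorem maxCharDegree_rpow_le_charDegreePowSum (G : Type) [Group G] [Finite G] (w : ℝ) :
    ((maxCharDegree G : ℕ) : ℝ) ^ w ≤ charDegreePowSum G w := by
  obtain ⟨r, d, hd, ⟨φ⟩⟩ := exists_algEquiv_pi_matrix G
  haveI : ∀ i, NeZero (d i) := hd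
  obtain ⟨i, hi⟩ := HartEtAl2013.exists_blockDegree_eq_maxCharDegree φ
  calc ((maxCharDegree G : ℕ) : ℝ) ^ w = ((d i : ℕ) : ℝ) ^ w := by rw [hi]
    _ ≤ ∑ j, ((d j : ℕ) : ℝ) ^ w :=
        Finset.single_le_sum (fun j _ => Real.rpow_nonneg (Nat.cast_nonneg _) w) (Finset.mem_univ i)
    _ ≤ charDegreePowSum G w := sum_blockDegrees_rpow_le_charDegreePowSum φ w

/-- **The floor, for any finite group**: if `N ≤ D_max(G)³` then `N^{w/3} ≤ Σ_χ χ(1)^w` for every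
`w ≥ 0` — Cohn–Umans' Thm. 4.1 inequality holds at every exponent, so a TPP triple of size `N`
bounds `ω` by nothing below `3`. [cite: CohnUmans2003, Thm. 4.1] -/
theorem rpow_le_charDegreePowSum_of_le_cube (G : Type) [Group G] [Finite G] {N : ℕ}
    (hN : N ≤ maxCharDegree G ^ 3) {w : ℝ} (hw : 0 ≤ w) :
    ((N : ℕ) : ℝ) ^ (w / 3) ≤ charDegreePowSum G w := by
  have hD0 : (0 : ℝ) ≤ (maxCharDegree G : ℝ) := Nat.cast_nonneg _
  have h1 : ((N : ℕ) : ℝ) ^ (w / 3) ≤ (((maxCharDegree G : ℕ) : ℝ) ^ 3) ^ (w / 3) :=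
    Real.rpow_le_rpow (Nat.cast_nonneg _) (by exact_mod_cast hN) (by linarith)
  have h2 : (((maxCharDegree G : ℕ) : ℝ) ^ 3) ^ (w / 3) = ((maxCharDegree G : ℕ) : ℝ) ^ w := by
    rw [← Real.rpow_natCast, ← Real.rpow_mul hD0]
    congr 1
    push_cast
    ring
  rw [h2] at h1
  exact h1.trans (maxCharDegree_rpow_le_charDegreePowSum G w)

/-- **The floor in `S_k`, explicit**: every triple of size `|S||T||U| ≤ (√(k!)·e^{−c₁√k})³ =
(k!)^{3/2} e^{−3c₁√k}` (`c₁ = π/√6`, so `3c₁ ≈ 3.85`) satisfies `(|S||T||U|)^{w/3} ≤ Σ_λ (f^λ)^w` for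
every `w ≥ 0` (Vershik–Kerov lower bound cubed). [cite: VershikKerov1985, Thm. 1] -/
theorem perm_uninformative_of_le {k N : ℕ}
    (hle : (N : ℝ) ≤ (Real.sqrt (k.factorial : ℝ) * Real.exp (-(vkLowerConst * Real.sqrt (k : ℝ)))) ^ 3)
    {w : ℝ} (hw : 0 ≤ w) :
    ((N : ℕ) : ℝ) ^ (w / 3) ≤ charDegreePowSum (Equiv.Perm (Fin k)) w := by
  have hpos : 0 ≤ Real.sqrt (k.factorial : ℝ) * Real.exp (-(vkLowerConst * Real.sqrt (k : ℝ))) :=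
    mul_nonneg (Real.sqrt_nonneg _) (Real.exp_pos _).le
  have h3 : (N : ℝ) ≤ ((maxCharDegree (Equiv.Perm (Fin k)) : ℕ) : ℝ) ^ 3 :=
    hle.trans (pow_le_pow_left₀ hpos (VershikKerov1985_maxCharDegree_lower k) 3)
  have hN : N ≤ maxCharDegree (Equiv.Perm (Fin k)) ^ 3 := by exact_mod_cast h3
  exact rpow_le_charDegreePowSum_of_le_cube (Equiv.Perm (Fin k)) hN hw

/-! ## §4 Necessity: beating a certificate forces small defect -/

/-- `#Cl(S_k) ≤ p(k)`: conjugate permutations have the same cycle type (Mathlib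
`Equiv.Perm.partition_eq_of_isConj`). [folklore] -/
theorem natCard_conjClasses_perm_le (k : ℕ) :
    Nat.card (ConjClasses (Equiv.Perm (Fin k))) ≤ Fintype.card (Nat.Partition k) := by
  classical
  let P : Equiv.Perm (Fin k) → (Fintype.card (Fin k)).Partition := fun σ => σ.partition
  let F : ConjClasses (Equiv.Perm (Fin k)) → (Fintype.card (Fin k)).Partition :=
    Quotient.lift P (fun σ τ (hστ : IsConj σ τ) => Equiv.Perm.partition_eq_of_isConj.mp hστ)
  have hF : Function.Injective F := by
    intro x y hxy
    obtain ⟨σ, rfl⟩ := ConjClasses.mk_surjective x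
    obtain ⟨τ, rfl⟩ := ConjClasses.mk_surjective y
    have hP : P σ = P τ := hxy
    exact ConjClasses.mk_eq_mk_iff_isConj.mpr (Equiv.Perm.partition_eq_of_isConj.mpr hP)
  simpa only [Fintype.card_fin, Nat.card_eq_fintype_card] using Nat.card_le_card_of_injective F hF

/-- `#Cl(S_k) ≤ e^{2c₁√k}` (`p(k) ≤ e^{π√(2k/3)}`, Apostol Thm. 14.5, tree `card_partition_le_exp'`).
[cite: Apostol1976, §14.7 Thm. 14.5] -/
theorem natCard_conjClasses_perm_le_exp (k : ℕ) :
    (Nat.card (ConjClasses (Equiv.Perm (Fin k))) : ℝ) ≤ Real.exp (2 * vkLowerConst * Real.sqrt k) := by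
  exact le_trans (mod_cast natCard_conjClasses_perm_le k) (card_partition_le_exp' k)

/-- **Beating the `w`-certificate forces `w·f < 3(w − 2)·c₁√k`.**  If a triple of size `N` in `S_k`
has `Σ_λ (f^λ)^w < N^{w/3}` for some `w ≥ 2` (it beats the bound (2.2) of Blasiak–Cohn–Grochow–
Pratt–Umans 2023 at `w`), then by the power-mean inequality `Σ_λ (f^λ)^w ≥ (k!)^{w/2} p(k)^{1−w/2}`
its packing defect satisfies `w·f < 3(w−2)·c₁√k`.  No TPP is needed. [cite: BlasiakCohnGrochowPrattUmans2023, Cor. 3.4 (proof)] -/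
theorem mul_packingDefect_lt_of_beats {k N : ℕ} {w : ℝ} (hw : 2 ≤ w)
    (hbeat : charDegreePowSum (Equiv.Perm (Fin k)) w < ((N : ℕ) : ℝ) ^ (w / 3)) :
    w * packingDefect k N < 3 * (w - 2) * (vkLowerConst * Real.sqrt k) := by
  set E : ℝ := Real.exp (2 * vkLowerConst * Real.sqrt k) with hE
  have hEpos : 0 < E := Real.exp_pos _
  have hKpos : (0 : ℝ) < Nat.card (ConjClasses (Equiv.Perm (Fin k))) := mod_cast Nat.card_pos
  have hfac : (0 : ℝ) < (k.factorial : ℝ) := factorial_cast_pos k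
  have hpm := card_rpow_mul_le_charDegreePowSum (Equiv.Perm (Fin k)) hw
  rw [Fintype.card_perm, Fintype.card_fin] at hpm
  have hexp : E ^ (1 - w / 2) ≤ (Nat.card (ConjClasses (Equiv.Perm (Fin k))) : ℝ) ^ (1 - w / 2) :=
    Real.rpow_le_rpow_of_nonpos hKpos (natCard_conjClasses_perm_le_exp k) (by linarith)
  have hA : (k.factorial : ℝ) ^ (w / 2) * E ^ (1 - w / 2) < ((N : ℕ) : ℝ) ^ (w / 3) :=
    calc (k.factorial : ℝ) ^ (w / 2) * E ^ (1 - w / 2)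
        ≤ (k.factorial : ℝ) ^ (w / 2) *
            (Nat.card (ConjClasses (Equiv.Perm (Fin k))) : ℝ) ^ (1 - w / 2) :=
          mul_le_mul_of_nonneg_left hexp (Real.rpow_nonneg hfac.le _)
      _ ≤ charDegreePowSum (Equiv.Perm (Fin k)) w := hpm
      _ < ((N : ℕ) : ℝ) ^ (w / 3) := hbeat
  have hApos : 0 < (k.factorial : ℝ) ^ (w / 2) * E ^ (1 - w / 2) :=
    mul_pos (Real.rpow_pos_of_pos hfac _) (Real.rpow_pos_of_pos hEpos _)
  have hNpos : (0 : ℝ) < (N : ℝ) := by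
    rcases Nat.eq_zero_or_pos N with h0 | hN
    · rw [h0, Nat.cast_zero, Real.zero_rpow (by linarith : w / 3 ≠ 0)] at hA
      exact absurd (hApos.trans hA) (lt_irrefl _)
    · exact_mod_cast hN
  have hlog := Real.log_lt_log hApos hA
  rw [Real.log_mul (Real.rpow_pos_of_pos hfac _).ne' (Real.rpow_pos_of_pos hEpos _).ne',
    Real.log_rpow hfac, Real.log_rpow hEpos, hE, Real.log_exp, Real.log_rpow hNpos] at hlog
  have key : 3 * (w - 2) * (vkLowerConst * Real.sqrt k) - w * packingDefect k N =
      3 * (w / 3 * Real.log (N : ℝ) -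
        (w / 2 * Real.log (k.factorial : ℝ) + (1 - w / 2) * (2 * vkLowerConst * Real.sqrt k))) := by
    simp only [packingDefect]; ring
  have : 0 < 3 * (w - 2) * (vkLowerConst * Real.sqrt k) - w * packingDefect k N := by
    rw [key]; linarith
  linarith

/-- **A family beating every certificate has defect `o(√k)` from above**: if for every `w > 2`
eventually `Σ_λ (f^λ)^w < Nᵢ^{w/3}` in `S_{kᵢ}`, then for every `η > 0` eventually `fᵢ < η√kᵢ`.
Together with `0 ≤ fᵢ` (`packingDefect_nonneg`) and the door
(`matrixMultiplication_of_perm_tpp_defect`): an `S_k`-family of TPP triples is an `ω = 2` family in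
the certificate sense iff its packing defect is `o(√k)`. [cite: BlasiakCohnGrochowPrattUmans2023, Cor. 3.4 (proof)] -/
theorem packingDefect_eventually_lt_of_beats (k N : ℕ → ℕ)
    (hbeat : ∀ w : ℝ, 2 < w → ∀ᶠ i in atTop,
      charDegreePowSum (Equiv.Perm (Fin (k i))) w < ((N i : ℕ) : ℝ) ^ (w / 3))
    {η : ℝ} (hη : 0 < η) :
    ∀ᶠ i in atTop, packingDefect (k i) (N i) < η * Real.sqrt (k i) := by
  have hc : 0 < vkLowerConst := div_pos Real.pi_pos (Real.sqrt_pos.mpr (by norm_num))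
  set w : ℝ := 2 + 2 * η / (3 * vkLowerConst) with hw
  have hw2 : 2 < w := by rw [hw]; have := div_pos (mul_pos two_pos hη) (mul_pos three_pos hc); linarith
  have hwc : 3 * (w - 2) * vkLowerConst = 2 * η := by rw [hw]; field_simp; ring
  filter_upwards [hbeat w hw2] with i hi
  have h := mul_packingDefect_lt_of_beats hw2.le hi
  have hs : 0 ≤ Real.sqrt (k i) := Real.sqrt_nonneg _
  have h1 : w * packingDefect (k i) (N i) < 2 * η * Real.sqrt (k i) := by
    calc w * packingDefect (k i) (N i) < 3 * (w - 2) * (vkLowerConst * Real.sqrt (k i)) := h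
      _ = 3 * (w - 2) * vkLowerConst * Real.sqrt (k i) := by ring
      _ = 2 * η * Real.sqrt (k i) := by rw [hwc]
  have h2 : 2 * η * Real.sqrt (k i) ≤ w * (η * Real.sqrt (k i)) := by
    have : 0 ≤ η * Real.sqrt (k i) := mul_nonneg hη.le hs
    nlinarith
  exact lt_of_mul_lt_mul_left (h1.trans_le h2) (by linarith : (0 : ℝ) ≤ w)

end SnWindow

end Summit.MatrixMultiplication.MatrixMultiplication.Theorems

end
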